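import Mathlib
import Summits.NavierStokesRegularity.NavierStokesRegularity.Theorems.EulerZoomLiouvillePowerGaugeEulerLiouvilleWindowFlux
import Summits.NavierStokesRegularity.NavierStokesRegularity.Theorems.EulerZoomLiouvillePowerGaugeEulerLiouvilleEnergyVanishingTools
import HarnessLib

/-!
# «NO EULER COLLAPSE FROM AN ENERGY-QUIESCENT PAST» in Seregin's power-gauged class
# (crux `EulerZoomLiouville.PowerGaugeEulerLiouville` = stmt-NavierStokesRegularity-19832, lead's line `birth`)

Route `EulerZoomLiouville` (NavierStokesRegularity).  The crux E: an ancient suitable weak Euler flow on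
`(−∞,0) × ℝ³` in Seregin's power-gauged class `a^{2ρ} A(a) + a^ρ E(a) + a^{2ρ} D(a) ≤ c` (all `a > 0`)
vanishes — OPEN on `0 < ρ ≤ 1/2` (⊇ the Chae–Shvydkoy window for self-similar Euler collapse).  Line `birth`:
`stub_largeRho` (landed) → `stub_backwardVanishing` (landed) → `stub_noCollapseFromZero` (OPEN core,
crux-sized).  This file is an IN-WINDOW STRATUM of the open core, the a.e.-robust softening of the landed rung
«no Euler collapse from rest» (`powerGaugeEulerLiouville_fromRest`, `2/5 < ρ`):

* `ae_eq_zero_of_gauge_of_windowFlux_of_energyVanishing` — **class member (any `ρ`) + finite WINDOW flux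
  `(|u|³+2|p||u|)/max(1,|x|) ∈ L¹((a,b) × ℝ³)` (`a < b < 0`) + ENERGY-QUIESCENT PAST (for every `ε > 0` and
  every `N`, the set of times `s < −N` with TOTAL energy `∫_{ℝ³} |u(s)|² ≤ ε` has positive measure) ⇒
  `u = 0` a.e.**  Mechanism: sliced local energy inequality from a.e. start `s₀` (tree
  `SuitableRestart.ae_energy_le_of_start_Ioo`, `ν = 0`) against the cut-offs `φ_R`:
  `e_R(t) ≤ e_R(s₀) + 2C ∫_{(s₀,t)×{|x|≥R}} (|u|³+2|p||u|)/max(1,|x|)`; now `e_R(s₀) ≤ ∫_{ℝ³}|u(s₀)|² ≤ ε`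
  for the quiescent start times, and the far-window flux `→ 0` as `R → ∞` for FIXED `s₀ < t` (no backward flux
  CAPACITY is needed — compare `…Flux.lean`, which fixes the ball and integrates the flux over the whole past).
* `powerGaugeEulerLiouville_of_energyVanishing` — **the crux VERBATIM plus the one hypothesis of an
  energy-quiescent past, unconditional for `2/5 < ρ`** (window flux from `windowFlux_integrableOn_of_gauge`).
  «From rest» (`u(t,·) = 0` for `t < −T`) is the special case `ε`-sets `= (−∞,−T)`.
* ENDPOINT `ρ = 1/2` (energy-conserving scaling): every member is finite-energy (`…EnergyVanishingTools.lean`),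
  so the stratum becomes the dichotomy of `…EnergyVanishingEndpoint.lean`: a nontrivial endpoint member
  carries its energy from `t = −∞`.

WHAT THIS IS NOT: not NS regularity, not the open core `stub_noCollapseFromZero` (which allows members whose
energy is present at `t = −∞`, e.g. the in-window self-similar/DSS profiles if they exist); a kernel-checked
in-window stratum `--supports` stmt-19832. [folklore]
-/

noncomputable section

set_option linter.dupNamespace false

open MeasureTheory Set Filter Topology Metric Function TopologicalSpace
open scoped ENNReal NNReal InnerProductSpace RealInnerProductSpace Laplacian

namespace Summit.NavierStokesRegularity.NavierStokesRegularity.Theorems.PowerGaugeEulerLiouville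

open Literature.Analysis Literature.Analysis.FunctionSpaces Literature.Analysis.FluidPDE

/-! ## The stratum: energy-quiescent past + finite window flux ⇒ trivial -/

/-- **A member of the power-gauged class with finite window flux and an energy-quiescent past vanishes.**
Let `(u, p)` be a suitable weak Euler flow on `(−∞,0) × ℝ³` with weak gradient `H` in Seregin's gauged
class (any `ρ`), whose weighted Euler flux `(|u|³ + 2|p||u|)/max(1,|x|)` is integrable on every finite
window `(a,b) × ℝ³` (`a < b < 0`), and whose past is ENERGY-QUIESCENT: for every `ε > 0` and every `N` the
set `{s < −N : ∫_{ℝ³} |u(s)|² ≤ ε}` has positive measure.  Then `u = 0` a.e.  Mechanism: the sliced local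
energy inequality from a.e. start (tree `SuitableRestart.ae_energy_le_of_start_Ioo`, `ν = 0`) against the
cut-offs `φ_R` gives `e_R(t) ≤ e_R(s₀) + 2C ∫_{(s₀,t)×{|x|≥R}} (|u|³+2|p||u|)/max(1,|x|)`; choose quiescent
good start times `s₀ < t` (`e_R(s₀) ≤ ∫|u(s₀)|² ≤ ε` for EVERY `R`), let `R → ∞` at fixed `(s₀,t)` (the
far-window flux vanishes), then `ε → 0`. [folklore] -/
theorem ae_eq_zero_of_gauge_of_windowFlux_of_energyVanishing {ρ : ℝ}
    {u : ℝ → EuclideanSpace ℝ (Fin 3) → EuclideanSpace ℝ (Fin 3)} {p : ℝ → EuclideanSpace ℝ (Fin 3) → ℝ}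
    {H : ℝ → EuclideanSpace ℝ (Fin 3) → EuclideanSpace ℝ (Fin 3) →L[ℝ] EuclideanSpace ℝ (Fin 3)} {c : ℝ≥0}
    (hsw : IsSuitableWeakSolutionOn (slab (EuclideanSpace ℝ (Fin 3)) (Iio 0) isOpen_Iio) 0 0 u p)
    (hH : HasWeakSpatialGradientOn (slab (EuclideanSpace ℝ (Fin 3)) (Iio 0) isOpen_Iio) u H)
    (hc : ∀ a : ℝ, 0 < a → ENNReal.ofReal (a ^ (2 * ρ)) * cknA a (0 : ℝ × EuclideanSpace ℝ (Fin 3)) u +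
        ENNReal.ofReal (a ^ ρ) * cknE a (0 : ℝ × EuclideanSpace ℝ (Fin 3)) H +
        ENNReal.ofReal (a ^ (2 * ρ)) * cknD a (0 : ℝ × EuclideanSpace ℝ (Fin 3)) p ≤ (c : ℝ≥0∞))
    (hwin : ∀ a b : ℝ, a < b → b < 0 → IntegrableOn
      (fun z : ℝ × EuclideanSpace ℝ (Fin 3) => (‖u z.1 z.2‖ ^ 3 + 2 * |p z.1 z.2| * ‖u z.1 z.2‖) / max 1 ‖z.2‖)
      (Ioo a b ×ˢ (univ : Set (EuclideanSpace ℝ (Fin 3)))) volume)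
    (hvan : ∀ ε : ℝ, 0 < ε → ∀ N : ℝ,
      volume {s : ℝ | s < -N ∧ ∫⁻ x, ‖u s x‖ₑ ^ 2 ≤ ENNReal.ofReal ε} ≠ 0) :
    uncurry u =ᵐ[volume.restrict (Iio (0 : ℝ) ×ˢ (univ : Set (EuclideanSpace ℝ (Fin 3))))] 0 := by
  have hE : ∀ a : ℝ, 0 < a →
      ENNReal.ofReal (a ^ ρ) * cknE a (0 : ℝ × EuclideanSpace ℝ (Fin 3)) H ≤ (c : ℝ≥0∞) :=
    fun a ha => le_trans (le_trans le_add_self le_self_add) (hc a ha)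
  have hA := hasScaledLocalEnergyBound_of_gaugeA (ρ := ρ)
    (fun a ha => le_trans (le_trans le_self_add le_self_add) (hc a ha))
  have hu3 := locallyIntegrableOn_cube_of_gauge hsw hH hE
  obtain ⟨C, hC0, hcut⟩ := cutoffFacts
  set Rk : ℕ → ℝ := fun k => (k : ℝ) + 1 with hRk
  have hRk1 : ∀ k, 1 ≤ Rk k := fun k => by simp only [hRk]; linarith [(Nat.cast_nonneg k : (0 : ℝ) ≤ k)]
  have hRk0 : ∀ k, 0 < Rk k := fun k => lt_of_lt_of_le one_pos (hRk1 k)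
  set φ : ℕ → EuclideanSpace ℝ (Fin 3) → ℝ := fun k => cutoff (Rk k) with hφdef
  have hφ : ∀ k, ContDiff ℝ (⊤ : ℕ∞) (φ k) := fun k => (hcut (Rk k) (hRk0 k)).1
  have hφc : ∀ k, HasCompactSupport (φ k) := fun k => (hcut (Rk k) (hRk0 k)).2.1
  have hφ0 : ∀ k x, 0 ≤ φ k x := fun k => (hcut (Rk k) (hRk0 k)).2.2.1
  have hφ1 : ∀ k x, φ k x ≤ 1 := fun k => (hcut (Rk k) (hRk0 k)).2.2.2.1
  have hφone : ∀ k, ∀ x ∈ ball (0 : EuclideanSpace ℝ (Fin 3)) (Rk k), φ k x = 1 :=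
    fun k => (hcut (Rk k) (hRk0 k)).2.2.2.2.1
  have hφin : ∀ k, ∀ x ∈ ball (0 : EuclideanSpace ℝ (Fin 3)) (Rk k), gradient (φ k) x = 0 :=
    fun k => (hcut (Rk k) (hRk0 k)).2.2.2.2.2.1
  have hφsupp : ∀ k x, φ k x ≠ 0 → x ∈ ball (0 : EuclideanSpace ℝ (Fin 3)) (2 * Rk k + 1) :=
    fun k => (hcut (Rk k) (hRk0 k)).2.2.2.2.2.2.1
  have hφgrad : ∀ k (x v : EuclideanSpace ℝ (Fin 3)), |⟪v, gradient (φ k) x⟫| ≤ C / Rk k * ‖v‖ :=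
    fun k => (hcut (Rk k) (hRk0 k)).2.2.2.2.2.2.2.1
  have hφout : ∀ k (x : EuclideanSpace ℝ (Fin 3)), 2 * Rk k < ‖x‖ → gradient (φ k) x = 0 :=
    fun k => (hcut (Rk k) (hRk0 k)).2.2.2.2.2.2.2.2
  set g : ℝ × EuclideanSpace ℝ (Fin 3) → ℝ :=
    fun z => (‖u z.1 z.2‖ ^ 3 + 2 * |p z.1 z.2| * ‖u z.1 z.2‖) / max 1 ‖z.2‖ with hgdef
  have hg0 : ∀ z, 0 ≤ g z := fun z => by simp only [hgdef]; positivity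
  -- the far-window flux bound `Δ_k(s₀,t)`
  set Dl : ℕ → ℝ → ℝ → ℝ := fun k s₀ t =>
    2 * C * ∫ z in Ico s₀ t ×ˢ {x : EuclideanSpace ℝ (Fin 3) | Rk k ≤ ‖x‖}, g z with hDldef
  have hgIco : ∀ s₀ t : ℝ, t < 0 →
      IntegrableOn g (Ico s₀ t ×ˢ (univ : Set (EuclideanSpace ℝ (Fin 3)))) volume := by
    intro s₀ t ht
    by_cases hst : s₀ < t
    · exact (hwin (s₀ - 1) t (by linarith) ht).mono_set
        (prod_mono (fun τ hτ => ⟨by linarith [hτ.1], hτ.2⟩) Subset.rfl)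
    · rw [Ico_eq_empty hst, empty_prod]
      exact integrableOn_empty
  have hDllim : ∀ s₀ t : ℝ, t < 0 → Tendsto (fun k : ℕ => Dl k s₀ t) atTop (𝓝 0) := by
    intro s₀ t ht
    have h := (tendsto_setIntegral_far_of_integrableOn measurableSet_Ico (hgIco s₀ t ht)).const_mul (2 * C)
    rw [mul_zero] at h
    exact h
  set e : ℕ → ℝ → ℝ := fun k t => ∫ x, ‖u t x‖ ^ 2 * φ k x with hedef
  have hmeasU : AEStronglyMeasurable (uncurry u)
      (volume.restrict (Iio (0 : ℝ) ×ˢ (univ : Set (EuclideanSpace ℝ (Fin 3))))) := by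
    have := hH.locallyIntegrableOn.aestronglyMeasurable
    simpa [slab] using this
  have hmeasP : AEStronglyMeasurable (uncurry p)
      (volume.restrict (Iio (0 : ℝ) ×ˢ (univ : Set (EuclideanSpace ℝ (Fin 3))))) := by
    have := hsw.distributional.2.2.1.aestronglyMeasurable
    simpa [slab] using this
  have hfluxle : ∀ (k : ℕ) (s₀ t : ℝ), t < 0 →
      ∫ z in Ico s₀ t ×ˢ (univ : Set (EuclideanSpace ℝ (Fin 3))),
        (‖u z.1 z.2‖ ^ 2 * (0 * Δ (φ k) z.2) + (‖u z.1 z.2‖ ^ 2 + 2 * p z.1 z.2) * ⟪u z.1 z.2, gradient (φ k) z.2⟫)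
        ≤ Dl k s₀ t := by
    intro k s₀ t ht
    set S : Set (ℝ × EuclideanSpace ℝ (Fin 3)) := Ico s₀ t ×ˢ (univ : Set (EuclideanSpace ℝ (Fin 3))) with hS
    have hSs : S ⊆ Iio (0 : ℝ) ×ˢ (univ : Set (EuclideanSpace ℝ (Fin 3))) :=
      prod_mono (fun τ hτ => lt_of_lt_of_le hτ.2 ht.le) Subset.rfl
    set F : ℝ × EuclideanSpace ℝ (Fin 3) → ℝ := fun z =>
      ‖u z.1 z.2‖ ^ 2 * (0 * Δ (φ k) z.2) + (‖u z.1 z.2‖ ^ 2 + 2 * p z.1 z.2) * ⟪u z.1 z.2, gradient (φ k) z.2⟫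
      with hF
    set T : Set (ℝ × EuclideanSpace ℝ (Fin 3)) := {z | Rk k ≤ ‖z.2‖} with hT
    have hTm : MeasurableSet T := measurableSet_le measurable_const (continuous_snd.norm).measurable
    set B : ℝ × EuclideanSpace ℝ (Fin 3) → ℝ := T.indicator (fun z => 2 * C * g z) with hB
    have hFB : ∀ z, |F z| ≤ B z := by
      intro z
      have h0 : F z = (‖u z.1 z.2‖ ^ 2 + 2 * p z.1 z.2) * ⟪u z.1 z.2, gradient (φ k) z.2⟫ := by
        simp only [hF, zero_mul, mul_zero, zero_add]
      have := abs_eulerFlux_cutoff_le hC0 (hRk1 k) (hφgrad k) (hφin k) (hφout k) (u z.1 z.2) (p z.1 z.2) z.2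
      rw [h0]
      refine this.trans (le_of_eq ?_)
      by_cases hz : Rk k ≤ ‖z.2‖
      · have hzT : z ∈ T := hz
        rw [indicator_of_mem (show z.2 ∈ {y : EuclideanSpace ℝ (Fin 3) | Rk k ≤ ‖y‖} from hz), hB,
          indicator_of_mem hzT, mul_one]
      · have hzT : z ∉ T := hz
        rw [indicator_of_notMem (show z.2 ∉ {y : EuclideanSpace ℝ (Fin 3) | Rk k ≤ ‖y‖} from hz), hB,
          indicator_of_notMem hzT, mul_zero]
    have hgS : IntegrableOn g S volume := hgIco s₀ t ht
    have hBint : IntegrableOn B S volume := (hgS.const_mul (2 * C)).indicator hTm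
    have hB0 : ∀ z, 0 ≤ B z := fun z =>
      indicator_nonneg (fun w _ => mul_nonneg (by positivity) (hg0 w)) _
    have hgradcont : Continuous (gradient (φ k)) := by
      have h1 : Continuous (fderiv ℝ (φ k)) := (hφ k).continuous_fderiv (by simp)
      exact (InnerProductSpace.toDual ℝ (EuclideanSpace ℝ (Fin 3))).symm.continuous.comp h1
    have hFmeas : AEStronglyMeasurable F (volume.restrict S) := by
      have hu' : AEStronglyMeasurable (uncurry u) (volume.restrict S) :=
        hmeasU.mono_measure (Measure.restrict_mono hSs le_rfl)
      have hp' : AEStronglyMeasurable (uncurry p) (volume.restrict S) :=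
        hmeasP.mono_measure (Measure.restrict_mono hSs le_rfl)
      have hgr : AEStronglyMeasurable (fun z : ℝ × EuclideanSpace ℝ (Fin 3) => gradient (φ k) z.2)
          (volume.restrict S) := (hgradcont.comp continuous_snd).aestronglyMeasurable
      have h1 : AEStronglyMeasurable (fun z : ℝ × EuclideanSpace ℝ (Fin 3) =>
          (‖uncurry u z‖ ^ 2 + 2 * uncurry p z) * ⟪uncurry u z, gradient (φ k) z.2⟫) (volume.restrict S) :=
        ((hu'.norm.pow 2).add (hp'.const_mul 2)).mul (hu'.inner hgr)
      refine h1.congr (Eventually.of_forall fun z => ?_)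
      simp only [hF, uncurry, zero_mul, mul_zero, zero_add]
    have hFint : IntegrableOn F S volume :=
      hBint.mono' hFmeas (Eventually.of_forall fun z => by rw [Real.norm_eq_abs]; exact hFB z)
    calc ∫ z in S, F z
        ≤ ∫ z in S, B z := integral_mono hFint hBint fun z => (le_abs_self _).trans (hFB z)
      _ = Dl k s₀ t := by
          rw [hB, setIntegral_indicator hTm, integral_const_mul]
          have hST : S ∩ T = Ico s₀ t ×ˢ {x : EuclideanSpace ℝ (Fin 3) | Rk k ≤ ‖x‖} := by
            ext z
            simp only [hS, hT, mem_inter_iff, mem_prod, mem_univ, and_true, mem_setOf_eq]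
          rw [hST]
  have hslab : ∀ n : ℕ, Ioo (-((n : ℝ) + 2)) 0 ×ˢ (univ : Set (EuclideanSpace ℝ (Fin 3))) ⊆
      ((slab (EuclideanSpace ℝ (Fin 3)) (Iio 0) isOpen_Iio : Opens (ℝ × EuclideanSpace ℝ (Fin 3))) :
        Set (ℝ × EuclideanSpace ℝ (Fin 3))) := by
    intro n z hz
    rw [SetLike.mem_coe, mem_slab]
    exact hz.1.2
  have hmono : ∀ n k : ℕ, ∀ᵐ s₀ ∂(volume : Measure ℝ), s₀ ∈ Ioo (-((n : ℝ) + 1)) (-(1 / ((n : ℝ) + 1))) →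
      ∀ᵐ t ∂(volume : Measure ℝ), t ∈ Ioo s₀ (-(1 / ((n : ℝ) + 1))) → e k t ≤ e k s₀ + Dl k s₀ t := by
    intro n k
    have hn1 : (0 : ℝ) < 1 / ((n : ℝ) + 1) := by positivity
    have h := SuitableRestart.ae_energy_le_of_start_Ioo hsw le_rfl hu3 (hslab n) (hφ k) (hφc k) (hφ0 k)
      (a' := -((n : ℝ) + 1)) (b' := -(1 / ((n : ℝ) + 1))) (by linarith) (by linarith)
    filter_upwards [h] with s₀ hs₀ hs₀mem
    filter_upwards [hs₀ hs₀mem] with t ht htmem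
    have htneg : t < 0 := lt_trans htmem.2 (by linarith)
    exact (ht htmem).trans (add_le_add le_rfl (hfluxle k s₀ t htneg))
  have hreg : ∀ᵐ s ∂(volume : Measure ℝ), s < 0 → AEStronglyMeasurable (u s) volume := by
    have h := ae_hasWeakGradient_slice_of_slab_Iio hH
    rw [ae_restrict_iff' measurableSet_Iio] at h
    filter_upwards [h] with s hs hslt
    have hl : LocallyIntegrable (u s) volume := locallyIntegrableOn_univ.1 (by
      simpa only [Opens.coe_top] using (hs hslt).locallyIntegrableOn)
    exact hl.aestronglyMeasurable
  set Good : ℝ → Prop := fun s₀ =>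
    (∀ n k : ℕ, s₀ ∈ Ioo (-((n : ℝ) + 1)) (-(1 / ((n : ℝ) + 1))) →
      ∀ᵐ t ∂(volume : Measure ℝ), t ∈ Ioo s₀ (-(1 / ((n : ℝ) + 1))) → e k t ≤ e k s₀ + Dl k s₀ t) ∧
    AEStronglyMeasurable (u s₀) volume with hGood
  have hgood : ∀ᵐ s₀ ∂(volume : Measure ℝ), s₀ < 0 → Good s₀ := by
    have h1 := ae_all_iff.2 fun n => ae_all_iff.2 fun k => hmono n k
    filter_upwards [h1, hreg] with s₀ h1 h2 hs₀
    exact ⟨fun n k => h1 n k, h2 hs₀⟩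
  -- quiescent good start times, arbitrarily far back
  have hpick : ∀ m N : ℕ, ∃ s₀ : ℝ, s₀ < -(N : ℝ) ∧ Good s₀ ∧
      ∫⁻ y, ‖u s₀ y‖ₑ ^ 2 ≤ ENNReal.ofReal (1 / ((m : ℝ) + 1)) := by
    intro m N
    set ε : ℝ := 1 / ((m : ℝ) + 1) with hε
    have hε0 : 0 < ε := by positivity
    set A : Set ℝ := {s : ℝ | s < -(N : ℝ) ∧ ∫⁻ y, ‖u s y‖ₑ ^ 2 ≤ ENNReal.ofReal ε} with hAdef
    have hApos : volume A ≠ 0 := hvan ε hε0 N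
    have hGc : volume {s : ℝ | ¬ (s < 0 → Good s)} = 0 := ae_iff.1 hgood
    obtain ⟨s₀, hs₀A, hs₀G⟩ : ∃ s₀, s₀ ∈ A ∧ (s₀ < 0 → Good s₀) := by
      by_contra hne
      apply hApos
      refine measure_mono_null (fun s hs => ?_) hGc
      intro hgoods
      exact hne ⟨s, hs, hgoods⟩
    have hs₀N : s₀ < -(N : ℝ) := hs₀A.1
    have hs₀neg : s₀ < 0 := lt_of_lt_of_le hs₀N (by simp)
    exact ⟨s₀, hs₀N, hs₀G hs₀neg, hs₀A.2⟩
  choose S hSN hSgood hSsmall using hpick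
  have hSneg : ∀ m N : ℕ, S m N < 0 := fun m N => lt_of_lt_of_le (hSN m N) (by simp)
  have heS : ∀ m N k : ℕ, e k (S m N) ≤ 1 / ((m : ℝ) + 1) := by
    intro m N k
    have hball : ∫⁻ y in ball (0 : EuclideanSpace ℝ (Fin 3)) (2 * Rk k + 1), ‖u (S m N) y‖ₑ ^ 2 ≤
        ENNReal.ofReal (1 / ((m : ℝ) + 1)) :=
      le_trans (setLIntegral_le_lintegral _ _) (hSsmall m N)
    have hfin : ∫⁻ y in ball (0 : EuclideanSpace ℝ (Fin 3)) (2 * Rk k + 1), ‖u (S m N) y‖ₑ ^ 2 < ⊤ :=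
      lt_of_le_of_lt hball ENNReal.ofReal_lt_top
    obtain ⟨-, hle⟩ := integrable_sq_mul_of_lintegral_ball (hSgood m N).2 hfin (hφ k).continuous (hφ0 k)
      (hφ1 k) (hφsupp k)
    refine hle.trans ?_
    have := ENNReal.toReal_mono ENNReal.ofReal_ne_top hball
    rwa [ENNReal.toReal_ofReal (by positivity)] at this
  have hall : ∀ᵐ t ∂(volume : Measure ℝ), ∀ m N k n : ℕ,
      S m N ∈ Ioo (-((n : ℝ) + 1)) (-(1 / ((n : ℝ) + 1))) →
        t ∈ Ioo (S m N) (-(1 / ((n : ℝ) + 1))) → e k t ≤ e k (S m N) + Dl k (S m N) t :=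
    ae_all_iff.2 fun m => ae_all_iff.2 fun N => ae_all_iff.2 fun k => ae_all_iff.2 fun n => by
      by_cases hmem : S m N ∈ Ioo (-((n : ℝ) + 1)) (-(1 / ((n : ℝ) + 1)))
      · filter_upwards [(hSgood m N).1 n k hmem] with t ht _ htmem
        exact ht htmem
      · exact Eventually.of_forall fun t h => (hmem h).elim
  -- at a.e. time `t < 0`: `e_k(t) ≤ 1/(m+1) + Δ_k(S m N, t)` for every `k, m`, with `N = ⌈−t⌉`
  have heD : ∀ᵐ t ∂(volume : Measure ℝ), t < 0 → ∀ k m : ℕ,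
      e k t ≤ 1 / ((m : ℝ) + 1) + Dl k (S m ⌈-t⌉₊) t := by
    filter_upwards [hall] with t ht htneg k m
    set N : ℕ := ⌈-t⌉₊ with hN
    have hSt : S m N < t := by
      have h1 : -t ≤ (N : ℝ) := Nat.le_ceil _
      have h2 := hSN m N
      linarith
    set s := S m N with hs
    set n : ℕ := ⌈-s⌉₊ + ⌈1 / (-t)⌉₊ with hn
    have hn1 : -((n : ℝ) + 1) < s := by
      have h1 : -s ≤ (⌈-s⌉₊ : ℝ) := Nat.le_ceil _
      have h2 : (n : ℝ) = (⌈-s⌉₊ : ℝ) + (⌈1 / (-t)⌉₊ : ℝ) := by rw [hn]; push_cast; ring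
      have h3 : (0 : ℝ) ≤ (⌈1 / (-t)⌉₊ : ℝ) := by positivity
      linarith
    have hn2 : t < -(1 / ((n : ℝ) + 1)) := by
      have h1 : 1 / (-t) ≤ (⌈1 / (-t)⌉₊ : ℝ) := Nat.le_ceil _
      have h2 : (n : ℝ) = (⌈-s⌉₊ : ℝ) + (⌈1 / (-t)⌉₊ : ℝ) := by rw [hn]; push_cast; ring
      have h3 : (0 : ℝ) ≤ (⌈-s⌉₊ : ℝ) := by positivity
      have h4 : 1 / (-t) < (n : ℝ) + 1 := by linarith
      have hnt : 0 < -t := by linarith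
      rw [div_lt_iff₀ hnt] at h4
      have h5 : 1 / ((n : ℝ) + 1) < -t := by
        rw [div_lt_iff₀ (by positivity), mul_comm]; exact h4
      linarith
    have hsmem : s ∈ Ioo (-((n : ℝ) + 1)) (-(1 / ((n : ℝ) + 1))) := ⟨hn1, hSt.trans hn2⟩
    exact (ht m N k n hsmem ⟨hSt, hn2⟩).trans (add_le_add (heS m N k) le_rfl)
  have hslice0 : ∀ᵐ t ∂(volume.restrict (Iio (0 : ℝ))), u t =ᵐ[volume] 0 := by
    rw [ae_restrict_iff' measurableSet_Iio]
    filter_upwards [heD, hreg] with t het hregt htmem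
    have htneg : t < 0 := htmem
    have hmeas := hregt htneg
    have hint : ∀ k : ℕ, Integrable (fun x => ‖u t x‖ ^ 2 * φ k x) volume := by
      intro k
      set a : ℝ := max (2 * Rk k + 1) (Real.sqrt (-t) + 1) with ha
      have ha0 : 0 < a := lt_of_lt_of_le (by linarith [hRk0 k]) (le_max_left _ _)
      have hta : t ∈ Ioo (-(a ^ 2)) 0 := by
        refine ⟨?_, htneg⟩
        have h1 : Real.sqrt (-t) ^ 2 = -t := Real.sq_sqrt (by linarith)
        have h2 : Real.sqrt (-t) + 1 ≤ a := le_max_right _ _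
        nlinarith [Real.sqrt_nonneg (-t)]
      have hfin : ∫⁻ y in ball (0 : EuclideanSpace ℝ (Fin 3)) (2 * Rk k + 1), ‖u t y‖ₑ ^ 2 < ⊤ :=
        lt_of_le_of_lt (lintegral_mono_set (ball_subset_ball (le_max_left _ _)))
          (lt_of_le_of_lt (hA a ha0 t hta) ENNReal.ofReal_lt_top)
      exact (integrable_sq_mul_of_lintegral_ball hmeas hfin (hφ k).continuous (hφ0 k) (hφ1 k) (hφsupp k)).1
    have hejk : ∀ j k : ℕ, 2 * j + 2 ≤ k → e j t ≤ e k t := by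
      intro j k hjk
      refine integral_mono (hint j) (hint k) fun x => ?_
      refine mul_le_mul_of_nonneg_left ?_ (sq_nonneg _)
      by_cases hx : φ j x = 0
      · rw [hx]; exact hφ0 k x
      · have h1 := hφsupp j x hx
        have h2 : x ∈ ball (0 : EuclideanSpace ℝ (Fin 3)) (Rk k) := by
          rw [mem_ball_zero_iff] at h1 ⊢
          have : 2 * Rk j + 1 ≤ Rk k := by
            simp only [hRk]
            have : (2 * j + 2 : ℕ) ≤ k := hjk
            have : (2 : ℝ) * j + 2 ≤ k := by exact_mod_cast this
            linarith
          linarith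
        rw [hφone k x h2]
        exact hφ1 j x
    have hej0 : ∀ j : ℕ, e j t = 0 := by
      intro j
      have hnn : 0 ≤ e j t := integral_nonneg fun x => mul_nonneg (sq_nonneg _) (hφ0 j x)
      refine le_antisymm ?_ hnn
      -- `e_j(t) ≤ 1/(m+1)` for every `m`: let `k → ∞` in `e_j ≤ e_k ≤ 1/(m+1) + Δ_k`
      have hbound : ∀ m : ℕ, e j t ≤ 1 / ((m : ℝ) + 1) := by
        intro m
        set N : ℕ := ⌈-t⌉₊ with hN
        have hev : ∀ᶠ k : ℕ in atTop, e j t ≤ 1 / ((m : ℝ) + 1) + Dl k (S m N) t := by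
          filter_upwards [eventually_ge_atTop (2 * j + 2)] with k hk
          exact (hejk j k hk).trans (het htneg k m)
        have hlim : Tendsto (fun k : ℕ => 1 / ((m : ℝ) + 1) + Dl k (S m N) t) atTop
            (𝓝 (1 / ((m : ℝ) + 1) + 0)) :=
          tendsto_const_nhds.add (hDllim (S m N) t htneg)
        rw [add_zero] at hlim
        exact ge_of_tendsto hlim hev
      have hlim : Tendsto (fun m : ℕ => 1 / ((m : ℝ) + 1)) atTop (𝓝 0) :=
        tendsto_one_div_add_atTop_nhds_zero_nat
      exact ge_of_tendsto' hlim hbound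
    have haej : ∀ j : ℕ, ∀ᵐ x ∂(volume : Measure (EuclideanSpace ℝ (Fin 3))),
        x ∈ ball (0 : EuclideanSpace ℝ (Fin 3)) (Rk j) → u t x = 0 := by
      intro j
      have hnn : 0 ≤ᵐ[volume] fun x => ‖u t x‖ ^ 2 * φ j x :=
        Eventually.of_forall fun x => mul_nonneg (sq_nonneg _) (hφ0 j x)
      have hae := (integral_eq_zero_iff_of_nonneg_ae hnn (hint j)).1 (hej0 j)
      filter_upwards [hae] with x hx hxj
      simp only [Pi.zero_apply, mul_eq_zero] at hx
      rcases hx with h | h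
      · exact norm_eq_zero.1 (by simpa using h)
      · exact absurd h (by rw [hφone j x hxj]; norm_num)
    have hall' := ae_all_iff.2 haej
    filter_upwards [hall'] with x hx
    obtain ⟨j, hj⟩ := exists_nat_gt ‖x‖
    exact hx j (mem_ball_zero_iff.2 (by simp only [hRk]; linarith))
  have hint : ∫⁻ z in Iio (0 : ℝ) ×ˢ (univ : Set (EuclideanSpace ℝ (Fin 3))), ‖uncurry u z‖ₑ = 0 := by
    have hm := hmeasU.aemeasurable.enorm
    rw [Measure.volume_eq_prod, ← Measure.restrict_prod_eq_prod_univ] at hm ⊢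
    rw [lintegral_prod _ hm]
    have hz : (fun t : ℝ => ∫⁻ y, ‖uncurry u (t, y)‖ₑ) =ᵐ[volume.restrict (Iio 0)] 0 := by
      filter_upwards [hslice0] with t ht
      have : (fun y => ‖uncurry u (t, y)‖ₑ) =ᵐ[volume] fun _ => 0 := by
        filter_upwards [ht] with y hy
        simp [uncurry, hy]
      rw [lintegral_congr_ae this]
      simp
    rw [lintegral_congr_ae hz]
    simp
  have hae := (lintegral_eq_zero_iff' hmeasU.aemeasurable.enorm).1 hint
  filter_upwards [hae] with z hz
  simpa using hz

/-- **«No Euler collapse from an energy-quiescent past» in Seregin's power-gauged class, unconditionally for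
`2/5 < ρ`.**  A suitable weak Euler flow on `(−∞,0) × ℝ³` in the class
`a^{2ρ} A(a) + a^ρ E(a) + a^{2ρ} D(a) ≤ c` (all `a > 0`) with `2/5 < ρ`, whose past is energy-quiescent
(for every `ε > 0` and `N`, the times `s < −N` with total energy `∫_{ℝ³}|u(s)|² ≤ ε` have positive measure —
i.e. `ess liminf_{s → −∞} ‖u(s)‖²_{L²(ℝ³)} = 0`), is identically zero: the crux `PowerGaugeEulerLiouville`
VERBATIM plus that one hypothesis.  It softens the landed «from rest» rung (`powerGaugeEulerLiouville_fromRest`)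
to an asymptotic, a.e.-robust hypothesis; in-window for `2/5 < ρ ≤ 1/2`. [folklore] -/
theorem powerGaugeEulerLiouville_of_energyVanishing :
    ∀ ρ : ℝ, 2 / 5 < ρ → ∀ (u : ℝ → EuclideanSpace ℝ (Fin 3) → EuclideanSpace ℝ (Fin 3))
      (p : ℝ → EuclideanSpace ℝ (Fin 3) → ℝ)
      (H : ℝ → EuclideanSpace ℝ (Fin 3) → EuclideanSpace ℝ (Fin 3) →L[ℝ] EuclideanSpace ℝ (Fin 3)) (c : ℝ≥0),
      IsSuitableWeakSolutionOn (slab (EuclideanSpace ℝ (Fin 3)) (Set.Iio 0) isOpen_Iio) 0 0 u p →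
      HasWeakSpatialGradientOn (slab (EuclideanSpace ℝ (Fin 3)) (Set.Iio 0) isOpen_Iio) u H →
      (∀ a : ℝ, 0 < a → ENNReal.ofReal (a ^ (2 * ρ)) * cknA a (0 : ℝ × EuclideanSpace ℝ (Fin 3)) u +
        ENNReal.ofReal (a ^ ρ) * cknE a (0 : ℝ × EuclideanSpace ℝ (Fin 3)) H +
        ENNReal.ofReal (a ^ (2 * ρ)) * cknD a (0 : ℝ × EuclideanSpace ℝ (Fin 3)) p ≤ (c : ℝ≥0∞)) →
      (∀ ε : ℝ, 0 < ε → ∀ N : ℝ,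
        volume {s : ℝ | s < -N ∧ ∫⁻ x, ‖u s x‖ₑ ^ 2 ≤ ENNReal.ofReal ε} ≠ 0) →
      Function.uncurry u =ᵐ[volume.restrict (Set.Iio (0 : ℝ) ×ˢ (Set.univ : Set (EuclideanSpace ℝ (Fin 3))))] 0 :=
  fun _ hρ _ _ _ _ hsw hH hc hvan =>
    ae_eq_zero_of_gauge_of_windowFlux_of_energyVanishing hsw hH hc
      (fun _ _ hab hb => windowFlux_integrableOn_of_gauge hρ hsw hH hc hab hb) hvan

end Summit.NavierStokesRegularity.NavierStokesRegularity.Theorems.PowerGaugeEulerLiouville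

end
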